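import Mathlib
import Summits.ValiantsHypothesis.ValiantsHypothesis.Theorems.NewtonUnitEquationsTwoProductsFormalLogLinearisationLiftedOverlapPencil
import HarnessLib

/-!
# Route NewtonUnitEquations — crux `TwoProducts` (stmt-ValiantsHypothesis-5906), line `formal-log-linearisation`:
# Hankel rank bounds every `I`-monotone chain of minimal nonzeros of an `n`-term exponential sum by `n` (no pencil)

Registered line `Cruxes/TwoProducts/Lines/formal-log-linearisation.lean` (NOT the item's skeleton of record; helper
mode `--supports stmt-ValiantsHypothesis-5906 --as helper`, no stub credit claimed).  Third file of the Hankel-rank /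
crossover tool (`…LiftedSeparatedPencil.lean`, `…LiftedOverlapPencil.lean`), now PENCIL-FREE.

For `F(ν) = Σ_{k ∈ κ} c_k ∏_i a_{ki}^{ν_i}` call `μ` a MINIMAL NONZERO if `F(μ) ≠ 0` and `F(ν) = 0` for every `ν ≤ μ`
(componentwise), `ν ≠ μ`; every point that is `θ`-minimal for some strictly positive grading — in particular every
pencil-visible point of the memo's `LiftedPencilCount` — is a minimal nonzero (`ExpSum.minimalNonzero_of_gradingMinimal`).
Fix a coordinate set `I`.  If the RESTRICTIONS `μ^a|_I` of a family of minimal nonzeros form a strictly increasing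
chain (componentwise `μ^a|_I ≤ μ^b|_I`, `μ^a|_I ≠ μ^b|_I` for `a < b`; nothing is asked off `I`), then the crossover
`(μ^a on I, μ^b off I)` (`a < b`) is componentwise below `μ^b` and different from it, so `F` vanishes there, while
`F(μ^a) ≠ 0` on the diagonal; the crossover matrix factors through `κ` (characters are multiplicative), hence

* `ExpSum.crossoverOn_eq` — `F` at the crossover `(μ on I, μ' off I)` as a `κ`-indexed bilinear expression;
* `ExpSum.monotoneChain_card_le` — **every family of minimal nonzeros whose `I`-restrictions increase strictly has at
  most `|κ|` elements** (any `s`, any `I`, no grading at all; equivalently: the `I`-restrictions of the minimal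
  nonzeros form a poset all of whose chains have length `≤ |κ|`);
* `unequalMoment_monotoneChain_card_le` — the two-configuration instance (`|κ| = 2m`).

This is the exact content of the rank method: it sees families whose restrictions to ONE coordinate set form a chain
and is blind to "support spread" (for `m = 1`, `A ≠ B` in every coordinate, the minimal nonzeros are `e_1,…,e_s` and
their `I`-restrictions `{0} ∪ {e_i : i ∈ I}` contain no strictly increasing chain of length `3`, for any `I`).  By
Dilworth, `#(minimal nonzeros) ≤ |κ| ·` (largest antichain of their `I`-restrictions), for every `I`.  An `m`-uniform `LiftedPencilCount` needs this multiplied by an additive count of splits,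
which stays OPEN.  Honest framing: elementary linear algebra for the THEORY lane of an OPEN engine; `stub_logSumEngine`,
the crux `TwoProducts` and `LiftedPencilCount` stay OPEN, the line is not the item's skeleton of record, and nothing
here is progress on `VP ≠ VNP` (NOT proved).  No definitions, no named facts. [folklore]
-/

noncomputable section

-- Sub = Summit single-conjunct layout: the duplicated namespace component is mandated by the tree.
set_option linter.dupNamespace false

namespace Summit.ValiantsHypothesis.ValiantsHypothesis.Theorems.NewtonUnitEquations.TwoProducts.FormalLogLinearisation

open scoped BigOperators

namespace ExpSum

variable {s : ℕ}

/-- **Characters are multiplicative** (coordinate-set form): with `cross = (μ on I, μ' off I)`,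
`Σ_k (c_k ∏_{i∈I} a_{ki}^{μ_i}) · ∏_{i∉I} a_{ki}^{μ'_i} = F(cross)`. [folklore] -/
theorem crossoverOn_eq {κ : Type*} [Fintype κ] (c : κ → ℂ) (a : κ → Fin s → ℂ) (I : Finset (Fin s))
    (μ μ' : Fin s → ℕ) :
    ∑ k, (c k * ∏ i, (if i ∈ I then a k i ^ μ i else 1)) *
        ∏ i, (if i ∈ I then (1 : ℂ) else a k i ^ μ' i) =
      ∑ k, c k * ∏ i, a k i ^ (fun i => if i ∈ I then μ i else μ' i) i := by
  refine Finset.sum_congr rfl fun k _ => ?_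
  rw [mul_assoc, ← Finset.prod_mul_distrib]
  congr 1
  refine Finset.prod_congr rfl fun i _ => ?_
  by_cases h : i ∈ I <;> simp [h]

/-- **Hankel rank bounds `I`-monotone chains of minimal nonzeros by the number of terms.**  Let
`F(ν) = Σ_{k ∈ κ} c_k ∏_i a_{ki}^{ν_i}` and let `μ^0, …, μ^{T-1}` be minimal nonzeros of `F` (`F(μ^a) ≠ 0`, and
`F(ν) = 0` for all `ν ≤ μ^a`, `ν ≠ μ^a`) such that for `a < b`: `μ^a ≤ μ^b` on `I` and `μ^a`, `μ^b` differ somewhere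
on `I` (no condition off `I`).  Then `T ≤ |κ|`: the crossover matrix `(F(μ^a on I, μ^b off I))_{a,b}` is lower
triangular with nonzero diagonal and factors through `κ`. [folklore] -/
theorem monotoneChain_card_le {κ : Type*} [Fintype κ] (c : κ → ℂ) (a : κ → Fin s → ℂ) (I : Finset (Fin s))
    {T : ℕ} (μ : Fin T → Fin s → ℕ)
    (hne : ∀ b, (∑ k, c k * ∏ i, a k i ^ μ b i) ≠ 0)
    (hmin : ∀ b (ν : Fin s → ℕ), ν ≤ μ b → ν ≠ μ b → (∑ k, c k * ∏ i, a k i ^ ν i) = 0)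
    (hI : ∀ a' b, a' < b → ∀ i ∈ I, μ a' i ≤ μ b i)
    (hdist : ∀ a' b, a' < b → ∃ i ∈ I, μ a' i ≠ μ b i) :
    T ≤ Fintype.card κ := by
  classical
  let cross : (Fin s → ℕ) → (Fin s → ℕ) → (Fin s → ℕ) := fun ν ν' i => if i ∈ I then ν i else ν' i
  let P : Matrix (Fin T) κ ℂ := fun b k => c k * ∏ i, (if i ∈ I then a k i ^ μ b i else 1)
  let Q : Matrix κ (Fin T) ℂ := fun k b => ∏ i, (if i ∈ I then (1 : ℂ) else a k i ^ μ b i)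
  have hPQ : ∀ a' b, (P * Q) a' b = ∑ k, c k * ∏ i, a k i ^ cross (μ a') (μ b) i := fun a' b => by
    simp only [Matrix.mul_apply, P, Q]
    exact crossoverOn_eq c a I (μ a') (μ b)
  refine card_le_of_triangular_factor' P Q (fun b => ?_) (fun a' b hab => ?_)
  · rw [hPQ]
    have : cross (μ b) (μ b) = μ b := by funext i; simp [cross]
    rw [this]
    exact hne b
  · rw [hPQ]
    refine hmin b (cross (μ a') (μ b)) (fun i => ?_) ?_
    · by_cases hi : i ∈ I
      · simp only [cross, hi, if_true]; exact hI a' b hab i hi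
      · simp only [cross, hi, if_false]; exact le_rfl
    · obtain ⟨i, hi, hneq⟩ := hdist a' b hab
      intro h
      have := congrFun h i
      simp only [cross, hi, if_true] at this
      exact hneq this

/-- **Minimality from a positive grading.**  If `μ` is `θ`-minimal in `{F ≠ 0}` for a strictly positive grading `θ`
(`F(ν) = 0` whenever `⟨θ,ν⟩ < ⟨θ,μ⟩`), then `μ` is a minimal nonzero: every `ν ≤ μ`, `ν ≠ μ` is strictly lighter.
[folklore] -/
theorem minimalNonzero_of_gradingMinimal {κ : Type*} [Fintype κ] (c : κ → ℂ) (a : κ → Fin s → ℂ)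
    (θ : Fin s → ℝ) (hθ : ∀ i, 0 < θ i) (μ : Fin s → ℕ)
    (hmin : ∀ ν : Fin s → ℕ, ∑ i, θ i * (ν i : ℝ) < ∑ i, θ i * (μ i : ℝ) →
      (∑ k, c k * ∏ i, a k i ^ ν i) = 0)
    (ν : Fin s → ℕ) (hle : ν ≤ μ) (hne : ν ≠ μ) : (∑ k, c k * ∏ i, a k i ^ ν i) = 0 := by
  refine hmin ν ?_
  obtain ⟨i, hi⟩ : ∃ i, ν i ≠ μ i := by
    by_contra h
    push Not at h
    exact hne (funext h)
  have hlt : ν i < μ i := lt_of_le_of_ne (hle i) hi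
  calc ∑ j, θ j * (ν j : ℝ) < ∑ j, θ j * (μ j : ℝ) :=
        Finset.sum_lt_sum (fun j _ => mul_le_mul_of_nonneg_left (by exact_mod_cast hle j) (hθ j).le)
          ⟨i, Finset.mem_univ i, mul_lt_mul_of_pos_left (by exact_mod_cast hlt) (hθ i)⟩

end ExpSum

/-- **Two configurations: every `I`-monotone chain of minimal unequal moments has at most `2m` elements.**  For
`A, B : Fin m → Fin s → ℂ`, if `μ^0, …, μ^{T-1}` have unequal moments, are componentwise-minimal with that property,
and their restrictions to `I` increase strictly (`μ^a ≤ μ^b` on `I`, `μ^a|_I ≠ μ^b|_I` for `a < b`), then `T ≤ 2m` —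
for every `s` and without any grading. [folklore] -/
theorem unequalMoment_monotoneChain_card_le {m s : ℕ} (A B : Fin m → Fin s → ℂ) (I : Finset (Fin s)) {T : ℕ}
    (μ : Fin T → Fin s → ℕ)
    (hne : ∀ b, (∑ j, ∏ i, A j i ^ μ b i) ≠ (∑ j, ∏ i, B j i ^ μ b i))
    (hmin : ∀ b (ν : Fin s → ℕ), ν ≤ μ b → ν ≠ μ b → (∑ j, ∏ i, A j i ^ ν i) = (∑ j, ∏ i, B j i ^ ν i))
    (hI : ∀ a b, a < b → ∀ i ∈ I, μ a i ≤ μ b i)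
    (hdist : ∀ a b, a < b → ∃ i ∈ I, μ a i ≠ μ b i) :
    T ≤ 2 * m := by
  have hcardκ : Fintype.card (Fin m ⊕ Fin m) = 2 * m := by simp [Fintype.card_sum, two_mul]
  rw [← hcardκ]
  refine ExpSum.monotoneChain_card_le (Sum.elim (fun _ => (1 : ℂ)) (fun _ => -1)) (Sum.elim A B) I μ
    (fun b => ?_) (fun b ν hle hneq => ?_) hI hdist
  · rw [unequalMoment_eq_expSum]; exact sub_ne_zero.2 (hne b)
  · rw [unequalMoment_eq_expSum]; exact sub_eq_zero.2 (hmin b ν hle hneq)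

end Summit.ValiantsHypothesis.ValiantsHypothesis.Theorems.NewtonUnitEquations.TwoProducts.FormalLogLinearisation

end
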